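import Summits.BirchSwinnertonDyer.Rank1Residual.X1.UnrSeriesFirstUnitCoeff
import HarnessLib

/-!
# ROAD B12 «λ-MATCHING TRANSFER» — the TRANSFER ALGEBRA in `R₀⟦T⟧`: the invariants-match input INV of the λ-matching cuts
# (p505319 @3, p507771 @p ≥ 5) from its four honest sources — the partner's IMC EQUALITY (anchor), the Σ-Euler factors,
# the analytic congruence of Σ-imprimitive BDP `L`-functions modulo the maximal ideal, and the equality of the
# Σ-imprimitive algebraic λ-invariants (items 20262 ∕ 20263 @3; 19282 ∕ 19702 ∕ 19703 @p ≥ 5)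

Cell `bsd-stepL` (run/shared/lean/pub/bsd-stepL/), seat `bsd-stepL-bdp` (prover g17, 2026-08-27). `--supports
stmt-BirchSwinnertonDyer-20262 --as helper`. THEOREMS ONLY; Theses-free; pure algebra in the X1 currency
FU(F, n) := «the first coefficient of F ∈ R₀⟦T⟧ of norm 1 sits at index n» (= μ(F) = 0 ∧ λ(F) = n, Washington Prop. 7.2),
spelled out inline. Memo: HOME/proof/PROOF-BDP.md §37 (37.1 mechanism, 37.10 analytic side, 37.11 algebraic side).

THE SHAPE IT CERTIFIES (Greenberg–Vatsal ∕ Emerton–Pollack–Weston, BDP currency; printed templates Lei–Müller–Xia 2023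
Thm 1, Nguyen arXiv:2503.00247 Thm A ∕ 7.5 at p ∤ N). Objects: `g, g′ ∈ Λ` generators of `Ch_Λ(X_E)`, `Ch_Λ(X_{E′})`;
`L, L′ ∈ R₀⟦T⟧` the BDP frames of `E`, `E′`; `P, P′ ∈ R₀⟦T⟧` the products of Euler factors over Σ (the SAME factor on the
algebraic and the analytic side of each curve — GV00 Prop. 2.4 ∕ Castella CJM18 (3.1)); `u` a unit (period ratio).
* `firstUnitCoeffAt_of_congr` — FU is invariant under congruence modulo the maximal ideal of `R₀` coefficientwise.
* `firstUnitCoeffAt_unit_mul`, `firstUnitCoeffAt_of_span_singleton_eq` — FU is invariant under unit multiples ∕ depends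
  only on the principal ideal.
* **`invariantsMatch_of_transfer`** — ANCHOR `(map g′) = (L′)` (IMC equality for the partner: YZ26 5.7 (1) @3 ∕ BCS25
  1.2.4 @5) ∧ FU(L′, n′) (μ(L′) = 0: Hsi14 Thm B) ∧ FU(P, m) ∧ FU(P′, m′) (Euler factors at split primes have μ = 0) ∧
  ANALYTIC CONGRUENCE «`u·L′·P′ ≡ L·P` coefficientwise mod 𝔪_{R₀}» (Nguyen Thm A shape; 37.10 at p ∥ N) ∧ ALGEBRAIC
  RESIDUAL EQUALITY «FU(map g·P, a) ∧ FU(map g′·P′, a)» (λ(X^Σ_E) = λ(X^Σ_{E′}), both μ = 0: 37.11's s + d − c) ⟹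
  **INV: `∃ n, FU(map g, n) ∧ FU(L, n)`** — verbatim the per-frame conjunct of `stub_inv3_invariantsMatch` ∕ hINV of
  p505319 ∕ p507771 (with `Ch = (g)` supplied by `charIdeal_isPrincipal_holds`).

HONEST FRAMING: algebra only; none of the four sources is asserted; nothing booked (T7).
References: [Washington1997] §7.1 Prop. 7.2; [GreenbergVatsal2000] §2, Prop. 2.4; [EmertonPollackWeston2006] Thm. 1;
[LeiMullerXia2023] Thm. 1; arXiv:2503.00247 Thm. A, 7.5; [Castella2018] (3.1).
-/

set_option autoImplicit false
set_option linter.dupNamespace false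

noncomputable section

open scoped Classical

open PowerSeries Literature.NumberTheory.EllipticCurves
  Summit.BirchSwinnertonDyer.Rank1Residual.X11b.Halves
  Summit.BirchSwinnertonDyer.Rank1Residual.X1.KellerYinHalves

namespace Summit.BirchSwinnertonDyer.BirchSwinnertonDyer.Theorems.LambdaMatching

variable {p : ℕ} [Fact p.Prime]

/-! ### §1 FU under congruence, unit multiples, equal principal ideals -/

/-- **FU is a mod-𝔪 invariant**: if `F ≡ G` coefficientwise modulo the maximal ideal of `R₀` (each
`‖F_i − G_i‖ < 1`) and the first unit coefficient of `F` sits at `n`, so does that of `G` (ultrametric inequality).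
[cite: Washington1997, §7.1 Prop. 7.2] -/
theorem firstUnitCoeffAt_of_congr {F G : UnrSeries p} {n : ℕ}
    (hFG : ∀ i, ‖((coeff i F : unrIntegers p) : ℂ_[p]) - ((coeff i G : unrIntegers p) : ℂ_[p])‖ < 1)
    (hF : ‖((coeff n F : unrIntegers p) : ℂ_[p])‖ = 1 ∧
      ∀ i < n, ‖((coeff i F : unrIntegers p) : ℂ_[p])‖ < 1) :
    ‖((coeff n G : unrIntegers p) : ℂ_[p])‖ = 1 ∧
      ∀ i < n, ‖((coeff i G : unrIntegers p) : ℂ_[p])‖ < 1 := by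
  have key : ∀ i, ((coeff i G : unrIntegers p) : ℂ_[p]) =
      ((coeff i F : unrIntegers p) : ℂ_[p]) +
        -(((coeff i F : unrIntegers p) : ℂ_[p]) - ((coeff i G : unrIntegers p) : ℂ_[p])) := fun i ↦ by ring
  refine ⟨?_, fun i hi ↦ ?_⟩
  · have hlt : ‖-(((coeff n F : unrIntegers p) : ℂ_[p]) - ((coeff n G : unrIntegers p) : ℂ_[p]))‖ <
        ‖((coeff n F : unrIntegers p) : ℂ_[p])‖ := by rw [norm_neg, hF.1]; exact hFG n
    rw [key n, IsUltrametricDist.norm_add_eq_max_of_norm_ne_norm hlt.ne', max_eq_left hlt.le, hF.1]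
  · rw [key i]
    refine (IsUltrametricDist.norm_add_le_max _ _).trans_lt (max_lt (hF.2 i hi) ?_)
    rw [norm_neg]
    exact hFG i

/-- **FU of a unit is at index `0`**: a unit of `R₀⟦T⟧` has a unit constant term. [folklore] -/
theorem firstUnitCoeffAt_zero_of_isUnit {U : UnrSeries p} (hU : IsUnit U) :
    ‖((coeff 0 U : unrIntegers p) : ℂ_[p])‖ = 1 ∧
      ∀ i < 0, ‖((coeff i U : unrIntegers p) : ℂ_[p])‖ < 1 := by
  refine ⟨?_, fun i hi ↦ absurd hi (Nat.not_lt_zero i)⟩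
  rw [coeff_zero_eq_constantCoeff_apply]
  exact (unrIntegers.isUnit_iff_norm_eq_one _).mp (PowerSeries.isUnit_constantCoeff U hU)

/-- **FU is invariant under unit multiples.** [cite: Washington1997, §7.1] -/
theorem firstUnitCoeffAt_unit_mul {U F : UnrSeries p} {n : ℕ} (hU : IsUnit U)
    (hF : ‖((coeff n F : unrIntegers p) : ℂ_[p])‖ = 1 ∧
      ∀ i < n, ‖((coeff i F : unrIntegers p) : ℂ_[p])‖ < 1) :
    ‖((coeff n (U * F) : unrIntegers p) : ℂ_[p])‖ = 1 ∧
      ∀ i < n, ‖((coeff i (U * F) : unrIntegers p) : ℂ_[p])‖ < 1 := by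
  have h := firstUnitCoeffAt_mul (firstUnitCoeffAt_zero_of_isUnit hU) hF
  rwa [zero_add] at h

/-- **FU depends only on the principal ideal**: `(F) = (L)` and FU(L, n) ⟹ FU(F, n). [cite: Washington1997, §7.1] -/
theorem firstUnitCoeffAt_of_span_singleton_eq {F L : UnrSeries p} {n : ℕ}
    (h : Ideal.span ({F} : Set (UnrSeries p)) = Ideal.span {L})
    (hL : ‖((coeff n L : unrIntegers p) : ℂ_[p])‖ = 1 ∧
      ∀ i < n, ‖((coeff i L : unrIntegers p) : ℂ_[p])‖ < 1) :
    ‖((coeff n F : unrIntegers p) : ℂ_[p])‖ = 1 ∧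
      ∀ i < n, ‖((coeff i F : unrIntegers p) : ℂ_[p])‖ < 1 := by
  obtain ⟨u, hu⟩ := Ideal.span_singleton_eq_span_singleton.mp h.symm
  -- `hu : L * u = F`
  rw [← hu, mul_comm]
  exact firstUnitCoeffAt_unit_mul u.isUnit hL

/-! ### §2 INV from the four sources -/

/-- **ROAD B12 — the invariants-match input from its sources.** For `E` (generator `g` of `Ch_Λ(X_E)`, frame `L`,
Σ-factor `P`) and a congruent partner `E′` (`g′`, `L′`, `P′`): the partner's IMC equality `(map g′) = (L′)` with
`μ(L′) = 0`, `λ(L′) = n′`; `μ = 0` for both Σ-factors; the analytic congruence `u·L′·P′ ≡ L·P (mod 𝔪)` for a unit `u`;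
and the equality of the Σ-imprimitive ALGEBRAIC invariants (both `μ = 0`, same `λ = a`) — imply INV: a common index
`n` with FU(map g, n) ∧ FU(L, n). Proof: FU(map g′, n′) (ideal invariance), so FU(map g′·P′, n′ + m′), whence
`a = n′ + m′` (uniqueness); FU(L′·P′, n′ + m′), FU(u·L′·P′, n′ + m′), FU(L·P, n′ + m′) (congruence); divide out `P` on
both sides (`exists_firstUnitCoeffAt_right`). [cite: Washington1997, §7.1 Prop. 7.2]
[cite: EmertonPollackWeston2006, Thm. 1 (the mechanism)] [cite: GreenbergVatsal2000, Prop. 2.4 (same local factors on both sides)] -/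
theorem invariantsMatch_of_transfer {g g' : IwasawaAlgebra p} {L L' P P' u : UnrSeries p} {n' m m' a : ℕ}
    (hanc : Ideal.span ({PowerSeries.map (toUnr p) g'} : Set (UnrSeries p)) = Ideal.span {L'})
    (hL' : ‖((coeff n' L' : unrIntegers p) : ℂ_[p])‖ = 1 ∧
      ∀ i < n', ‖((coeff i L' : unrIntegers p) : ℂ_[p])‖ < 1)
    (hP : ‖((coeff m P : unrIntegers p) : ℂ_[p])‖ = 1 ∧
      ∀ i < m, ‖((coeff i P : unrIntegers p) : ℂ_[p])‖ < 1)
    (hP' : ‖((coeff m' P' : unrIntegers p) : ℂ_[p])‖ = 1 ∧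
      ∀ i < m', ‖((coeff i P' : unrIntegers p) : ℂ_[p])‖ < 1)
    (hu : IsUnit u)
    (hcong : ∀ i, ‖((coeff i (u * (L' * P')) : unrIntegers p) : ℂ_[p]) -
      ((coeff i (L * P) : unrIntegers p) : ℂ_[p])‖ < 1)
    (halg : ‖((coeff a (PowerSeries.map (toUnr p) g * P) : unrIntegers p) : ℂ_[p])‖ = 1 ∧
      ∀ i < a, ‖((coeff i (PowerSeries.map (toUnr p) g * P) : unrIntegers p) : ℂ_[p])‖ < 1)
    (halg' : ‖((coeff a (PowerSeries.map (toUnr p) g' * P') : unrIntegers p) : ℂ_[p])‖ = 1 ∧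
      ∀ i < a, ‖((coeff i (PowerSeries.map (toUnr p) g' * P') : unrIntegers p) : ℂ_[p])‖ < 1) :
    ∃ n : ℕ, (‖((coeff n (PowerSeries.map (toUnr p) g) : unrIntegers p) : ℂ_[p])‖ = 1 ∧
        ∀ i < n, ‖((coeff i (PowerSeries.map (toUnr p) g) : unrIntegers p) : ℂ_[p])‖ < 1) ∧
      (‖((coeff n L : unrIntegers p) : ℂ_[p])‖ = 1 ∧
        ∀ i < n, ‖((coeff i L : unrIntegers p) : ℂ_[p])‖ < 1) := by
  -- the partner: FU(map g', n'), hence FU(map g' · P', n' + m') and a = n' + m'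
  have hg' := firstUnitCoeffAt_of_span_singleton_eq hanc hL'
  have hgP' := firstUnitCoeffAt_mul hg' hP'
  have ha : n' + m' = a := firstUnitCoeff_unique hgP' halg'
  -- the analytic side: FU(L' · P', n' + m') ⟹ FU(u · L' · P', n' + m') ⟹ FU(L · P, n' + m') = FU(L · P, a)
  have hLP' := firstUnitCoeffAt_mul hL' hP'
  have huLP' := firstUnitCoeffAt_unit_mul hu hLP'
  have hLP : ‖((coeff a (L * P) : unrIntegers p) : ℂ_[p])‖ = 1 ∧
      ∀ i < a, ‖((coeff i (L * P) : unrIntegers p) : ℂ_[p])‖ < 1 := by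
    rw [← ha]
    exact firstUnitCoeffAt_of_congr hcong huLP'
  -- divide out `P` on both sides
  have hLP₁ : ‖((coeff a (P * L) : unrIntegers p) : ℂ_[p])‖ = 1 ∧
      ∀ i < a, ‖((coeff i (P * L) : unrIntegers p) : ℂ_[p])‖ < 1 := by rwa [mul_comm] at hLP
  have hgP₁ : ‖((coeff a (P * PowerSeries.map (toUnr p) g) : unrIntegers p) : ℂ_[p])‖ = 1 ∧
      ∀ i < a, ‖((coeff i (P * PowerSeries.map (toUnr p) g) : unrIntegers p) : ℂ_[p])‖ < 1 := by
    rwa [mul_comm] at halg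
  obtain ⟨b, hb, hmb⟩ := exists_firstUnitCoeffAt_right hP hLP₁
  obtain ⟨b', hb', hmb'⟩ := exists_firstUnitCoeffAt_right hP hgP₁
  obtain rfl : b = b' := by omega
  exact ⟨b, hb', hb⟩

end Summit.BirchSwinnertonDyer.BirchSwinnertonDyer.Theorems.LambdaMatching

end
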